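import Mathlib
import HarnessLib

/-!
# `t`-polynomial solutions `Σ_i binom(m,i) ẽ_{m−i}(x) tⁱ` of `ψ_tt − ψ_xx + Vψ = 0` from a chain

Analysis/PDE support file (everything proved, no definitions). If `ẽ_0, …, ẽ_ℓ : ℝ → ℝ` are `C²`
and satisfy the chain relation `ẽ_j'' = V ẽ_j + j(j−1) ẽ_{j−2}` on `x > ½` (the true non-radiative
chain of `InverseSquareCorrectedChain.lean`, or the exact one `c_j ι^{ℓ−j}` of
`InverseSquareExactChain.lean` with `V = ℓ(ℓ+1)ι²`), then for every `m ≤ ℓ` the `t`-polynomial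

  `p_m(t, x) = Σ_{i ≤ m} binom(m, i) ẽ_{m−i}(x) tⁱ`

is globally `C²` in `(t, x)` and solves `p_tt − p_xx + V p = 0` on `{x > ½} × ℝ`
(`correctedTower_wave`: the identity is `binom(m,i+2)(i+2)(i+1) = binom(m,i)(m−i)(m−i−1)`), with
Cauchy data `p_m(0,·) = ẽ_m`, `∂_t p_m(0,·) = m ẽ_{m−1}` and the derivative formulas
`∂_t p = Σ binom ẽ_{m−i} i t^{i−1}`, `∂_x p = Σ binom ẽ_{m−i}' tⁱ` (`correctedTower_data`,
`correctedTower_derivs`). These are the (true or exact) t-polynomial kernel elements on the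
null-infinity side of the Regge–Wheeler channel estimate `FixedModeChannels`
(route PhotonSphereChannels, stmt-FinalStateConjecture-10048); for the exact chain they are the
classical non-radiative solutions of Kenig–Lawrie–Liu–Schlag (2015). Folklore.
-/

noncomputable section

namespace Literature.Analysis.PDE

open Set Filter Topology Finset

section Towers

variable {V : ℝ → ℝ} {E : ℕ → ℝ → ℝ} {ℓ m : ℕ}

/-- The binomial re-indexing identity `binom(m,i+2)(i+2)(i+1) = binom(m,i)(m−i)((m−i)−1)` over `ℝ`.
[folklore] -/
theorem choose_shift_two (m i : ℕ) :
    ((m.choose (i + 2) : ℕ) : ℝ) * ((i : ℝ) + 2) * ((i : ℝ) + 1)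
      = (m.choose i : ℝ) * (((m - i : ℕ) : ℝ) * (((m - i : ℕ) : ℝ) - 1)) := by
  have h1 := Nat.choose_succ_right_eq m (i + 1)
  have h2 := Nat.choose_succ_right_eq m i
  -- `choose m (i+2) (i+2) (i+1) = choose m i (m-i) (m-i-1)` in `ℕ`
  have hN : m.choose (i + 2) * (i + 2) * (i + 1) = m.choose i * (m - i) * (m - i - 1) := by
    rw [show i + 2 = i + 1 + 1 by ring, h1, show m - (i + 1) = m - i - 1 by omega, mul_assoc,
      mul_comm (m - i - 1) (i + 1), ← mul_assoc, h2]
  have hR : ((m.choose (i + 2) : ℕ) : ℝ) * ((i : ℝ) + 2) * ((i : ℝ) + 1)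
      = (m.choose i : ℝ) * ((m - i : ℕ) : ℝ) * ((m - i - 1 : ℕ) : ℝ) := by exact_mod_cast hN
  rw [hR]
  rcases Nat.eq_zero_or_pos (m - i) with h0 | hpos
  · rw [h0]; simp
  · rw [Nat.cast_sub (show 1 ≤ m - i from hpos)]; push_cast; ring

/-- Second `t`-derivative of a monomial: `(tⁱ)'' = i (i−1) t^{i−2}` (natural subtraction). [folklore] -/
theorem iteratedDeriv_two_pow (i : ℕ) (t : ℝ) :
    iteratedDeriv 2 (fun τ : ℝ => τ ^ i) t = (i : ℝ) * ((i - 1 : ℕ) : ℝ) * t ^ (i - 2) := by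
  rw [iteratedDeriv_pow]
  have : ((i.descFactorial 2 : ℕ) : ℝ) = (i : ℝ) * ((i - 1 : ℕ) : ℝ) := by
    rw [Nat.descFactorial_succ, Nat.descFactorial_succ, Nat.descFactorial_zero, Nat.sub_zero, mul_one]
    push_cast; ring
  rw [this]

variable (hC : ∀ j, j ≤ ℓ → ContDiff ℝ 2 (E j))
  (hD : ∀ j, j ≤ ℓ → ∀ x, 1 / 2 < x →
    deriv (deriv (E j)) x = V x * E j x + (j : ℝ) * (j - 1) * E (j - 2) x)
  (hm : m ≤ ℓ)
include hC hm

/-- The tower is globally `C²` in `(t, x)`. [folklore] -/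
theorem correctedTower_contDiff :
    ContDiff ℝ 2 (Function.uncurry fun t x =>
      ∑ i ∈ range (m + 1), (m.choose i : ℝ) * E (m - i) x * t ^ i) := by
  have : (Function.uncurry fun t x => ∑ i ∈ range (m + 1), (m.choose i : ℝ) * E (m - i) x * t ^ i)
      = fun z : ℝ × ℝ => ∑ i ∈ range (m + 1), (m.choose i : ℝ) * E (m - i) z.2 * z.1 ^ i := by
    funext z; rfl
  rw [this]
  refine ContDiff.sum fun i _ => ?_
  exact ((contDiff_const.mul ((hC (m - i) (by omega)).comp contDiff_snd)).mul (contDiff_fst.pow i))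

/-- Cauchy data of the tower: `p(0,·) = ẽ_m`, `∂_t p(0,·) = m ẽ_{m−1}`, and the general derivative
formulas `∂_t p = Σ binom ẽ_{m−i} i t^{i−1}`, `∂_x p = Σ binom ẽ_{m−i}' tⁱ`. [folklore] -/
theorem correctedTower_derivs (t x : ℝ) :
    deriv (fun τ => ∑ i ∈ range (m + 1), (m.choose i : ℝ) * E (m - i) x * τ ^ i) t
        = ∑ i ∈ range (m + 1), (m.choose i : ℝ) * E (m - i) x * ((i : ℝ) * t ^ (i - 1)) ∧
      deriv (fun y => ∑ i ∈ range (m + 1), (m.choose i : ℝ) * E (m - i) y * t ^ i) x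
        = ∑ i ∈ range (m + 1), (m.choose i : ℝ) * deriv (E (m - i)) x * t ^ i := by
  constructor
  · rw [deriv_fun_sum fun i _ => by fun_prop]
    refine sum_congr rfl fun i _ => ?_
    rw [deriv_const_mul _ (differentiableAt_pow i), deriv_pow_field]
  · have hd : ∀ i ∈ range (m + 1), DifferentiableAt ℝ (fun y => (m.choose i : ℝ) * E (m - i) y * t ^ i) x :=
      fun i _ => (((hC (m - i) (by omega)).differentiable (by norm_num) x).const_mul _).mul_const _
    rw [deriv_fun_sum hd]
    refine sum_congr rfl fun i _ => ?_
    rw [deriv_mul_const (((hC (m - i) (by omega)).differentiable (by norm_num) x).const_mul _),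
      deriv_const_mul _ ((hC (m - i) (by omega)).differentiable (by norm_num) x)]

/-- Cauchy data at `t = 0`: `p(0,x) = ẽ_m(x)` and `∂_t p(0,x) = m ẽ_{m−1}(x)`. [folklore] -/
theorem correctedTower_data (x : ℝ) :
    (∑ i ∈ range (m + 1), (m.choose i : ℝ) * E (m - i) x * (0 : ℝ) ^ i) = E m x ∧
      deriv (fun τ => ∑ i ∈ range (m + 1), (m.choose i : ℝ) * E (m - i) x * τ ^ i) 0
        = (m : ℝ) * E (m - 1) x := by
  constructor
  · rw [Finset.sum_eq_single 0 (fun i _ hi => by simp [hi]) (by simp)]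
    simp
  · rw [(correctedTower_derivs hC hm 0 x).1]
    rcases Nat.eq_zero_or_pos m with h0 | hpos
    · subst h0; simp
    · rw [Finset.sum_eq_single 1 (fun i _ hi => ?_) (fun h => absurd (mem_range.2 (by omega)) h)]
      · simp
      · rcases Nat.lt_or_gt_of_ne hi with h | h
        · have : i = 0 := by omega
          simp [this]
        · have : i - 1 ≠ 0 := by omega
          simp [this]

include hD

/-- **The tower solves the wave equation** `p_tt − p_xx + V p = 0` on `{x > ½}`. [folklore] -/
theorem correctedTower_wave (t : ℝ) {x : ℝ} (hx : 1 / 2 < x) :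
    iteratedDeriv 2 (fun τ => ∑ i ∈ range (m + 1), (m.choose i : ℝ) * E (m - i) x * τ ^ i) t
      - iteratedDeriv 2 (fun y => ∑ i ∈ range (m + 1), (m.choose i : ℝ) * E (m - i) y * t ^ i) x
      + V x * ∑ i ∈ range (m + 1), (m.choose i : ℝ) * E (m - i) x * t ^ i = 0 := by
  -- the `t`-derivatives
  have hA : iteratedDeriv 2 (fun τ => ∑ i ∈ range (m + 1), (m.choose i : ℝ) * E (m - i) x * τ ^ i) t
      = ∑ i ∈ range (m + 1), (m.choose i : ℝ) * E (m - i) x * ((i : ℝ) * ((i - 1 : ℕ) : ℝ) * t ^ (i - 2)) := by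
    rw [iteratedDeriv_fun_sum fun i _ => by fun_prop]
    refine sum_congr rfl fun i _ => ?_
    rw [iteratedDeriv_const_mul_field, iteratedDeriv_two_pow]
  -- the `x`-derivatives
  have hB : iteratedDeriv 2 (fun y => ∑ i ∈ range (m + 1), (m.choose i : ℝ) * E (m - i) y * t ^ i) x
      = ∑ i ∈ range (m + 1), (m.choose i : ℝ) * (V x * E (m - i) x
          + (((m - i : ℕ) : ℝ)) * (((m - i : ℕ) : ℝ) - 1) * E (m - i - 2) x) * t ^ i := by
    have hCi : ∀ i ∈ range (m + 1), ContDiffAt ℝ 2 (fun y => (m.choose i : ℝ) * E (m - i) y * t ^ i) x :=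
      fun i _ => ((contDiff_const.mul (hC (m - i) (by omega))).mul contDiff_const).contDiffAt
    rw [iteratedDeriv_fun_sum hCi]
    refine sum_congr rfl fun i _ => ?_
    have e1 : (fun y => (m.choose i : ℝ) * E (m - i) y * t ^ i)
        = fun y => ((m.choose i : ℝ) * t ^ i) * E (m - i) y := by funext y; ring
    rw [e1, iteratedDeriv_const_mul_field, iteratedDeriv_succ, iteratedDeriv_one,
      hD (m - i) (by omega) x hx, show m - i - 2 = m - i - 2 from rfl]
    ring
  rw [hA, hB]
  -- reduce to the re-indexing identity
  set f : ℕ → ℝ := fun i => (m.choose i : ℝ) * E (m - i) x * ((i : ℝ) * ((i - 1 : ℕ) : ℝ) * t ^ (i - 2))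
    with hf
  set g : ℕ → ℝ := fun i => (m.choose i : ℝ) * ((((m - i : ℕ) : ℝ)) * (((m - i : ℕ) : ℝ) - 1)
    * E (m - i - 2) x) * t ^ i with hg
  have key : ∑ i ∈ range (m + 1), f i = ∑ i ∈ range (m + 1), g i := by
    -- extend the left sum by two vanishing terms and shift
    have hf0 : f 0 = 0 := by simp [hf]
    have hf1' : f (0 + 1) = 0 := by simp [hf]
    have hext : ∑ i ∈ range (m + 1), f i = ∑ i ∈ range (m + 3), f i := by
      refine Finset.sum_subset (range_subset_range.2 (by omega)) fun i hi hni => ?_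
      have hlt : m < i := by
        rw [Finset.mem_range] at hi hni; omega
      simp only [hf]
      rw [Nat.choose_eq_zero_of_lt hlt]
      simp
    rw [hext, Finset.sum_range_succ', Finset.sum_range_succ', hf0, add_zero, hf1', add_zero]
    refine sum_congr rfl fun i _ => ?_
    simp only [hf, hg]
    have hc := choose_shift_two m i
    rw [show m - (i + 1 + 1) = m - i - 2 by omega, show i + 1 + 1 - 2 = i by omega]
    have hcast : (((i + 1 + 1 - 1 : ℕ) : ℝ)) = (i : ℝ) + 1 := by
      rw [show i + 1 + 1 - 1 = i + 1 by omega]; push_cast; ring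
    rw [hcast]
    have hchoose : ((m.choose (i + 1 + 1) : ℕ) : ℝ) * (((i + 1 + 1 : ℕ) : ℝ) * ((i : ℝ) + 1))
        = (m.choose i : ℝ) * (((m - i : ℕ) : ℝ) * (((m - i : ℕ) : ℝ) - 1)) := by
      rw [← hc]; push_cast; ring
    calc ((m.choose (i + 1 + 1) : ℕ) : ℝ) * E (m - i - 2) x * ((((i + 1 + 1 : ℕ) : ℝ)) * ((i : ℝ) + 1) * t ^ i)
        = (((m.choose (i + 1 + 1) : ℕ) : ℝ) * (((i + 1 + 1 : ℕ) : ℝ) * ((i : ℝ) + 1))) * E (m - i - 2) x * t ^ i := by ring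
      _ = ((m.choose i : ℝ) * (((m - i : ℕ) : ℝ) * (((m - i : ℕ) : ℝ) - 1))) * E (m - i - 2) x * t ^ i := by rw [hchoose]
      _ = _ := by ring
  -- conclude
  have hsplit : ∑ i ∈ range (m + 1), (m.choose i : ℝ) * (V x * E (m - i) x
        + ((m - i : ℕ) : ℝ) * (((m - i : ℕ) : ℝ) - 1) * E (m - i - 2) x) * t ^ i
      = V x * ∑ i ∈ range (m + 1), (m.choose i : ℝ) * E (m - i) x * t ^ i + ∑ i ∈ range (m + 1), g i := by
    rw [mul_sum, ← sum_add_distrib]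
    refine sum_congr rfl fun i _ => ?_
    simp only [hg]; ring
  rw [hsplit, show (∑ i ∈ range (m + 1), (m.choose i : ℝ) * E (m - i) x
      * ((i : ℝ) * ((i - 1 : ℕ) : ℝ) * t ^ (i - 2))) = ∑ i ∈ range (m + 1), f i from rfl, key]
  ring

end Towers

end Literature.Analysis.PDE
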